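import Literature.MathematicalPhysics.QuantumFieldTheory.Balaban1983to89.T4AxialGaugeSmallField
import Literature.MathematicalPhysics.QuantumFieldTheory.Balaban1983to89.AveragingRT
import Literature.MathematicalPhysics.QuantumFieldTheory.Balaban1983to89.B6Ineq2123CentredTorus
import HarnessLib

/-!
# DAG node N07 [B11] — the BLOCK-WISE AXIAL GAUGE TRIVIAL AT THE BLOCK CENTRES ([6] (1.14)–(1.15) at one level), generic gauge group: for every
# configuration a gauge transformation `g` with `g = 1` at every block centre whose action makes every WITHIN-BLOCK bond `(d−1)(L−1)·a`-close to `1`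
# wherever the block's plaquettes are `a`-close to `1`, and which moves NO block average — the `τ`∕`hint` hypothesis of `…N07Lemma1CrossingBonds` discharged

Cell `pub-ymgap` (HUMAN RULINGS D-0062 ∕ D-0149 ∕ D-0154), width seat `pub-ymgap-dag-n07-w5` g0, 2026-08-28.  `--kind proof --supports
stmt-QuantumFields-20542 --as helper` (K1⁷; count-neutral helper on the N07 [B11] row; dag-lead WIDTH-209 N07 piece 1b, DEDUP-382; fourth file of this seat).

THE PRINT.  [6] = T. Bałaban, *Spaces of regular gauge field configurations on a lattice and gauge fixing conditions*, Commun. Math. Phys. **99** (1985)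
75–102 `[Balaban1985RegularSpaces]`, p. 78: «the set 𝔅_k(𝔅_k, V) is invariant with respect to gauge transformations u satisfying the conditions u(y) = 1 for
y ∈ 𝔅_k. (1.14) … An axial gauge is defined by the equations … U(Γ_{x₁,x}) = 1 for x ∈ B(x₁). (1.15) It is easy to see that these equations together with
(1.14) for gauge transformations determine uniquely an element in each orbit.»; p. 79–80 (proof of Lemma 1): «The conditions (R₀V′)(Γ_{y,x}) = 1, x ∈ B(y),
imply V′_b = 1 for b ⊂ Γ_{y,x}. This and the above estimate imply |V′_b − 1| < (d−1)(L−1)2α₀L⁻² for b ⊂ B(y)».  [B7] = CMP **98** (1985) 17–51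
`[Balaban1985Averaging]`, (11) p. 19 (covariance of the averaging); [I] = CMP **109** (1987) 249–301 `[Balaban1987RG1]`, (0.1)∕(0.3) pp. 251–252 (blocks).

WHAT THIS FILE DOES (kernel bookkeeping over pv26's torus non-abelian Poincaré lemma `T4AxialGaugeSmallField`; generic torus `P : Params`, standing
range `j + 1 ≤ m + K`, ANY gauge group).  pv26's `axialGauge U lo hi` gauges ONE box from its corner; the block-wise gauge of a whole level is the
lambda `g x := (G_{y(x)} (emb y(x)))⁻¹ · G_{y(x)} x`, `y(x) = blockOf x`, `G_y := axialGauge U (L·y) (L·y + L − 1)` — per block pv26's gauge re-normalised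
at the CENTRE (so that `g ∘ emb = 1`, the subgroup (1.14), and no block average moves).  Since `dist1` is conjugation invariant the within-block bound of
pv26 survives the re-normalisation.
* §1 the block ↔ box dictionary: `blockSite_eq_castSite` (`blockSite y r = castSite (L·y + r)`) (leaving a block through its far face lands in the next
  block = r18's `BIJ85CurlQsstar.shift_blockSite_of_eq`, `y + e_μ ≠ y` = `B6Ineq2123CentredTorus.shift_ne_self`, both BY NAME), ★ `mem_boxBonds_of_blockOf_eq` (a bond with BOTH ends in `B(y)` is a bond of the box `[L·y, L·y + L − 1]`), ★ `blockOf_of_mem_boxPlaqs_block` (the box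
  plaquettes of that box are based in `B(y)`).
* §2 ★★★ `exists_blockwiseGauge` — for every `U`: `∃ g`, (i) `g (emb y) = 1` for all `y`; (ii) for every `a ≥ 0`, every `y` with `dist1 (U(∂q)) < a` for
  the plaquettes based in `B(y)`, and every bond `b` with both ends in `B(y)`: `dist1 (U^g(b)) ≤ (d − 1)(L − 1)·a`; (iii) for EVERY averaging
  `av : Setup.Averaging P j G`: `av.avg (U^g) = av.avg U` (covariance (11) at `g ∘ emb = 1`).

HONEST FRAMING (binding).  Count-neutral helper; one-level reading of (1.14)–(1.15) only — print's hierarchical `Ax_k(𝔅_k, U₀)` ((1.19), the AVERAGED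
configurations axial at every lower level) is NOT constructed; the constant `(d − 1)(L − 1)` is pv26's corner-rooted count (print's centre-rooted comb
would give `(d − 1)(L − 1)∕2`); nothing of [B11]∕[6] analysis asserted.  Tokens ∕ stub 1 ∕ K0⁷ ∕ K1⁷ NOT closed; N07 NOT discharged (5∕27 unmoved); one
finite `T⁴` programme at fixed `ε`, Bałaban AS PRINTED — R4 closes rung `BalabanLadder.UV` only; no summit statement is proved by this seat; NOT
continuum ∕ ℝ⁴ ∕ OS ∕ mass gap ∕ Clay.  No `sorry`, no `def`, no `instance`, no `notation`.
-/

noncomputable section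

namespace Summit.QuantumFields.YangMills.BalabanUVNodes.N07Lemma1BlockGauge

open Literature.MathematicalPhysics.QuantumFieldTheory.Balaban1983to89
open T4AxialGaugeSmallField (axialGauge boxPlaqs boxBonds castSite dist1_gaugeAct_axialGauge_le_of_mem_boxBonds)
open B7Prop1Explicit (e e_apply)
open GaugeField (gaugeAct)

variable {P : Params} {j : ℕ}

/-! ## §1  Blocks as integer boxes `[L·y, L·y + L − 1]` of pv26 -/

/-- `blockSite y r` is the torus image of the integer point `L·y + r`. [cite: Balaban1987RG1, (0.1) p.251 (bookkeeping)] -/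
theorem blockSite_eq_castSite (y : Site P (j + 1)) (r : Fin P.d → Fin P.L) :
    Site.blockSite y r = castSite (fun κ => (((y κ).val * P.L + r κ : ℕ) : ℤ)) := by
  funext κ
  simp only [Site.blockSite, castSite, Int.cast_natCast]

/-- ★ **A BOND WITH BOTH ENDS IN `B(y)` IS A BOND OF THE INTEGER BOX `[L·y, L·y + L − 1]`** (pv26's `boxBonds`; standing range).
[cite: Balaban1985RegularSpaces, (1.15) p.78 (the bonds of B(x₁)); Balaban1987RG1, (0.3) p.252] -/
theorem mem_boxBonds_of_blockOf_eq (hj : j + 1 ≤ P.m + P.K) (y : Site P (j + 1)) (b : PBond P j) (hsrc : blockOf b.src = y)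
    (htgt : blockOf b.tgt = y) :
    b ∈ boxBonds (fun κ => (((y κ).val * P.L : ℕ) : ℤ)) (fun κ => (((y κ).val * P.L + (P.L - 1) : ℕ) : ℤ)) := by
  have hL := P.hL.2
  set r := Site.blockEquiv hj y ⟨b.src, hsrc⟩ with hr
  have hx : Site.blockSite y r = b.src := by
    have := (Site.blockEquiv hj y).left_inv ⟨b.src, hsrc⟩
    exact congrArg Subtype.val this
  -- the far face is excluded: `r_{dir} + 1 < L`
  have hface : (r b.dir : ℕ) + 1 < P.L := by
    have hle : (r b.dir : ℕ) + 1 ≤ P.L := (r b.dir).isLt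
    rcases hle.lt_or_eq with hlt | heq
    · exact hlt
    · exfalso
      apply B6Ineq2123CentredTorus.shift_ne_self y b.dir
      have h1 : b.tgt = Site.blockSite (y.shift b.dir) (Function.update r b.dir ⟨0, P.L_pos⟩) := by
        rw [PBond.tgt, ← hx,
          Literature.MathematicalPhysics.QuantumFieldTheory.BalabanImbrieJaffe1984to88.BIJ85CurlQsstar.shift_blockSite_of_eq hj y r b.dir heq]
      have h2 := htgt
      rw [h1, Site.blockOf_blockSite hj] at h2
      exact h2
  refine ⟨fun κ => (((y κ).val * P.L + r κ : ℕ) : ℤ), fun κ => ?_, fun κ => ?_, ?_⟩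
  · simp only
    push_cast
    exact le_add_of_nonneg_right (by positivity)
  · simp only [Pi.add_apply, e_apply]
    by_cases hκ : κ = b.dir
    · subst hκ
      rw [if_pos rfl]
      push_cast
      have : ((r b.dir : ℕ) : ℤ) + 1 ≤ ((P.L - 1 : ℕ) : ℤ) := by omega
      linarith
    · rw [if_neg hκ]
      push_cast
      have h1 : ((r κ : ℕ) : ℤ) ≤ ((P.L - 1 : ℕ) : ℤ) := by have := (r κ).isLt; omega
      linarith
  · rw [← hx, blockSite_eq_castSite]

/-- ★ **THE BOX PLAQUETTES OF THE BLOCK BOX ARE BASED IN THE BLOCK**: a plaquette of pv26's `boxPlaqs [L·y, L·y + L − 1]` has its base site in `B(y)`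
(centred coordinates, `blockOf_eq_of_near_emb`; standing range). [cite: Balaban1987RG1, (0.3) p.252] -/
theorem blockOf_of_mem_boxPlaqs_block (hj : j + 1 ≤ P.m + P.K) (y : Site P (j + 1)) {q : Plaq P j}
    (hq : q ∈ boxPlaqs (fun κ => (((y κ).val * P.L : ℕ) : ℤ)) (fun κ => (((y κ).val * P.L + (P.L - 1) : ℕ) : ℤ))) :
    blockOf q.src = y := by
  have hL := AveragingRT.two_mul_half_add_one P
  have hL2 := P.hL.2
  obtain ⟨z, hlo, hhi, hsrc⟩ := hq
  -- centred coordinates `e ν = z ν − (L·y ν + (L−1)/2)`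
  refine T4Continuum.blockOf_eq_of_near_emb hj y q.src (fun ν => z ν - (((y ν).val * P.L + (P.L - 1) / 2 : ℕ) : ℤ)) (fun ν => ?_) (fun ν => ?_)
  · rw [hsrc]
    simp only [castSite, emb, Int.cast_sub, Int.cast_natCast]
    ring
  · have h1 := hlo ν
    have h2 := hhi ν
    simp only [Pi.add_apply, e_apply] at h1 h2
    have h3 : (0 : ℤ) ≤ (if ν = q.μ then 1 else 0) := by split_ifs <;> norm_num
    have h4 : (0 : ℤ) ≤ (if ν = q.ν then 1 else 0) := by split_ifs <;> norm_num
    constructor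
    · push_cast; omega
    · push_cast; omega

/-! ## §2  The block-wise gauge trivial at the centres -/

variable {G : Type*} [GaugeGroup G]

/-- ★★★ **THE BLOCK-WISE AXIAL GAUGE TRIVIAL AT THE BLOCK CENTRES** ([6] (1.14)–(1.15) at one level, generic gauge group, standing range): for every
configuration `U` of `T^{(j)}` there is a gauge transformation `g` with (i) `g = 1` at every block centre `emb y` (the subgroup (1.14)); (ii) for every
`a ≥ 0`, every block `B(y)` whose plaquettes (base site in `B(y)`) are within `a` of `1`, and every bond `b` with both ends in `B(y)`:
`dist1 (U^g(b)) ≤ (d − 1)(L − 1)·a` (print: «|V′_b − 1| < (d−1)(L−1)2α₀L⁻² for b ⊂ B(y)»; constant = pv26's corner-rooted tree count); (iii) NO block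
average moves: `av.avg (U^g) = av.avg U` for every `Setup.Averaging` (covariance (11)).  The element is explicit:
`g x = (G_{y(x)} (emb y(x)))⁻¹ · G_{y(x)} x`, `G_y := axialGauge U (L·y) (L·y + L − 1)`, `y(x) = blockOf x`.
[cite: Balaban1985RegularSpaces, (1.14)-(1.15) p.78, p.80 l.1; Balaban1985Averaging, (11) p.19] -/
theorem exists_blockwiseGauge (hj : j + 1 ≤ P.m + P.K) (U : GaugeField P j G) :
    ∃ g : GaugeTransf P j G,
      (∀ y : Site P (j + 1), g (emb y) = 1) ∧
      (∀ (a : ℝ), 0 ≤ a → ∀ y : Site P (j + 1), (∀ q : Plaq P j, blockOf q.src = y → dist1 (GaugeField.plaqHol U q) < a) →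
        ∀ b : PBond P j, blockOf b.src = y → blockOf b.tgt = y →
          dist1 (gaugeAct g U b) ≤ ((P.d - 1 : ℕ) : ℝ) * ((P.L - 1 : ℕ) : ℝ) * a) ∧
      (∀ av : Averaging P j G, av.avg (gaugeAct g U) = av.avg U) := by
  have hL2 := P.hL.2
  -- the block boxes and pv26's gauge per block
  let lo : Site P (j + 1) → Fin P.d → ℤ := fun y κ => (((y κ).val * P.L : ℕ) : ℤ)
  let hi : Site P (j + 1) → Fin P.d → ℤ := fun y κ => (((y κ).val * P.L + (P.L - 1) : ℕ) : ℤ)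
  let Gy : Site P (j + 1) → GaugeTransf P j G := fun y => axialGauge U (lo y) (hi y)
  let g : GaugeTransf P j G := fun x => (Gy (blockOf x) (emb (blockOf x)))⁻¹ * Gy (blockOf x) x
  refine ⟨g, fun y => ?_, fun a ha y hplaq b hsrc htgt => ?_, fun av => ?_⟩
  · -- (i) trivial at the centres
    show (Gy (blockOf (emb y)) (emb (blockOf (emb y))))⁻¹ * Gy (blockOf (emb y)) (emb y) = 1
    rw [Site.blockOf_emb hj]
    exact inv_mul_cancel _
  · -- (ii) within-block bonds: conjugate of pv26's axial-gauge bond by the constant `G_y (emb y)`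
    have hconj : gaugeAct g U b = (Gy y (emb y))⁻¹ * gaugeAct (Gy y) U b * ((Gy y (emb y))⁻¹)⁻¹ := by
      show (Gy (blockOf b.src) (emb (blockOf b.src)))⁻¹ * Gy (blockOf b.src) b.src * U b *
          ((Gy (blockOf b.tgt) (emb (blockOf b.tgt)))⁻¹ * Gy (blockOf b.tgt) b.tgt)⁻¹ =
        (Gy y (emb y))⁻¹ * (Gy y b.src * U b * (Gy y b.tgt)⁻¹) * ((Gy y (emb y))⁻¹)⁻¹
      rw [hsrc, htgt]
      group
    rw [hconj, GaugeGroup.dist1_conj]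
    have hn : ∀ κ, hi y κ ≤ lo y κ + ((P.L - 1 : ℕ) : ℤ) := fun κ => by
      show (((y κ).val * P.L + (P.L - 1) : ℕ) : ℤ) ≤ (((y κ).val * P.L : ℕ) : ℤ) + ((P.L - 1 : ℕ) : ℤ)
      push_cast
      exact le_rfl
    have hnN : P.L - 1 < P.sitesPerDir j := by
      rw [P.sitesPerDir_eq_mul_succ hj]
      have h1 := P.one_lt_sitesPerDir (j + 1)
      have h2 : P.sitesPerDir (j + 1) * P.L ≥ 2 * P.L := Nat.mul_le_mul_right _ h1
      omega
    have hS₀ : boxPlaqs (lo y) (hi y) ⊆ {q : Plaq P j | blockOf q.src = y} := fun q hq => blockOf_of_mem_boxPlaqs_block hj y hq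
    exact dist1_gaugeAct_axialGauge_le_of_mem_boxBonds U hS₀ (fun q hq => hplaq q hq) ha hn hnN
      (mem_boxBonds_of_blockOf_eq hj y b hsrc htgt)
  · -- (iii) no block average moves (covariance at `g ∘ emb = 1`)
    rw [av.covariant hj g U]
    funext c
    show g (emb c.src) * av.avg U c * (g (emb c.tgt))⁻¹ = av.avg U c
    have h1 : g (emb c.src) = 1 := by
      show (Gy (blockOf (emb c.src)) (emb (blockOf (emb c.src))))⁻¹ * Gy (blockOf (emb c.src)) (emb c.src) = 1
      rw [Site.blockOf_emb hj]; exact inv_mul_cancel _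
    have h2 : g (emb c.tgt) = 1 := by
      show (Gy (blockOf (emb c.tgt)) (emb (blockOf (emb c.tgt))))⁻¹ * Gy (blockOf (emb c.tgt)) (emb c.tgt) = 1
      rw [Site.blockOf_emb hj]; exact inv_mul_cancel _
    rw [h1, h2, one_mul, inv_one, mul_one]

end Summit.QuantumFields.YangMills.BalabanUVNodes.N07Lemma1BlockGauge

end
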